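import Literature.Barriers.AnomalousDissipation.ShearFlowViscositySelectionSteps
import Literature.Analysis.FluidPDE.PassiveScalar
import HarnessLib

/-!
# Bardos–Titi–Wiedemann 2012, Thm. 5 — proof architecture, part 2: the vanishing-viscosity
limit; Lemma 4 and the subsequential limit as named facts, the assembly of Thm. 5 proved

Second companion to `Literature/Barriers/AnomalousDissipation/ShearFlowViscositySelection.lean`
(named fact `BardosTitiWiedemann2012_thm5`: Bardos–Titi–Wiedemann, C. R. Math. 350 (2012),
Thm. 5) after `ShearFlowViscositySelectionSteps.lean` (parts (i) existence — proved — and (ii)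
uniqueness — named fact `BardosTitiWiedemann2012_thm5_uniqueness`).

Part (iii) of the theorem — "these solutions `u^ν` converge weak-* in `L^∞([0,T];L²(T³))` to
the shear flow … as `ν → 0`" — is printed as follows (op. cit., proof of Thm. 5): "since the
family of unique solutions, `u^ν`, is uniformly bounded in `L^∞_t L²_x`, there exists a
subsequence `u^{ν_k}` which converges weak-* to `u ∈ L^∞_t L²_x`, and `u` satisfies [the linear
system (6): `u₁ = v₁`, `u₂ = 0`, `∂ₜu₃ + v₁(x₂)∂₁u₃ = 0`, `u₃(0) = v₃`] … it follows from Lemma 4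
above that system (6) has a unique solution, and that this unique solution is given precisely
by the shear flow (4) … Finally, this uniqueness implies that the whole sequence `u^ν`, and not
just a subsequence, converges to the shear flow solution (4)."

## This file

* `shearVelocity v`, `shearTransport v w₀ t` — the planar shear velocity field `(v(x₂), 0)` on
  `T²` and the transported profile `w₀(x₁ - t v(x₂), x₂)` of Lemma 4 (paper coordinates `x₁, x₂`
  ↦ indices `0, 1`), with the unfolding lemmas `shearTransport_zero`,
  `shearFlow_apply` (the third component of the shear flow (4) is the shear transport of
  `v₃`) and `shearVelocity_add_single_zero`.
* `BardosTitiWiedemann2012_lemma4` — **named fact**, Lemma 4 as printed: for `v ∈ L²(T)`,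
  `w₀ ∈ L²(T²)`, the Cauchy problem `∂ₜw + v(x₂)∂₁w = 0`, `w(0) = w₀` has a solution in
  `C([0,T];L²_w(T²))` in the sense of distributions, unique in `L^∞((0,T);L²(T²))`; weak
  solutions are rendered by the accepted `Torus.IsWeakScalarTransportOn T 0 (shearVelocity v) w₀`
  (`Literature/Analysis/FluidPDE/PassiveScalar`, DiPerna–Lions class, `κ = 0`), whose membership
  clause *is* `L^∞(0,T;L²)`.
* `BardosTitiWiedemann2012_thm5_subseqLimit` — **named fact**, the displayed step of the printed
  proof: every vanishing-viscosity sequence of Leray–Hopf solutions with shear datum has a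
  subsequence converging weak-* (accepted `Torus.TendstoWeakStar`) to the shear flow. This is the
  analytic heart of part (iii) (uniform bound, weak-* compactness, the heat-flow limit
  `u₁^ν → v₁`, the limit equation (6), Lemma 4). As a statement quantified over all
  vanishing-viscosity Leray–Hopf sequences it is **equivalent** to conjunct (iii) of
  `BardosTitiWiedemann2012_thm5` (sub-subsequence principle one way,
  `BardosTitiWiedemann2012_thm5_limit_of_subseqLimit`; `φ = id` the other,
  `BardosTitiWiedemann2012_thm5_subseqLimit_of_thm5`); it is kept in the subsequential shape
  because that is what compactness arguments produce.
* **Proved**: the uniform energy bound of unforced Leray–Hopf solutions in the `∫⁻`-form used by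
  `Torus.TendstoWeakStar` (`lintegral_enorm_sq_le_of_isLerayHopfOn`, from the energy inequality,
  Leray 1934, (5.2)); the sub-subsequence principle for weak-* convergence
  (`tendstoWeakStar_of_forall_subseq`, Mathlib's `Filter.tendsto_of_subseq_tendsto` test field by
  test field — the printed "this uniqueness implies that the whole sequence … converges"); part
  (iii) from the subsequential fact (`BardosTitiWiedemann2012_thm5_limit_of_subseqLimit`) and
  the converse (`BardosTitiWiedemann2012_thm5_subseqLimit_of_thm5`); and the **assembly**
  `BardosTitiWiedemann2012_thm5_of_facts : …_uniqueness → …_subseqLimit →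
  BardosTitiWiedemann2012_thm5`.

After this file the remaining discharge of `BardosTitiWiedemann2012_thm5` is exactly its
conjuncts (ii) and (iii): the named facts `BardosTitiWiedemann2012_thm5_uniqueness` (conjunct
(ii) verbatim; Bardos–Lopes Filho–Niu–Nussenzveig Lopes–Titi 2013, Thm. 3.1) and
`BardosTitiWiedemann2012_thm5_subseqLimit` (equivalent to conjunct (iii); its own inputs are
`BardosTitiWiedemann2012_thm5_shearLerayHopf`, the uniqueness fact again, the heat-flow limit,
weak-* compactness, the limit equation (6) and `BardosTitiWiedemann2012_lemma4`).

## Status (2026-08-17)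

Both named facts of this file are now theorems in the tree, so the file carries no literature debt:
`BardosTitiWiedemann2012_lemma4_holds` (`ShearFlowViscositySelectionLemma4`: existence by the explicit shear
transport of `ShearFlowViscositySelectionTransport`, uniqueness in `L^∞_tL²_x` by duality — dual tests along the
characteristics of the Fourier-truncated profile, using no regularity of `v` beyond `L²`),
`BardosTitiWiedemann2012_thm5_subseqLimit_holds` (`ShearFlowViscositySelectionSubseqLimitHolds`, from
`BardosTitiWiedemann2012_thm5_holds` in `ShearFlowViscositySelectionHolds`, itself assembled from the
discharges of the `2½`-D Leray–Hopf structure, the heat-flow limit, the limit equation (6), Lemma 4 and the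
weak–strong uniqueness theorem `Torus.lerayHopf_ae_eq_of_invariant_datum`), and the assembly
`BardosTitiWiedemann2012_thm5_of_facts` below fed with `BardosTitiWiedemann2012_thm5_uniqueness_holds` and
`BardosTitiWiedemann2012_thm5_subseqLimit_holds` re-proves Thm. 5 (axioms `propext`, `Classical.choice`,
`Quot.sound`; barrier audits 2026-08-17, gens 1–4, logged in `ShearFlowViscositySelection.lean`). The barrier
card (technique class, blocks, evasions, scope caveats) sits on `BardosTitiWiedemann2012_thm5` in that parent
file; the words "named fact" in the docstrings below record provenance (what is printed), not open debt.

## References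

* C. Bardos, E. S. Titi, E. Wiedemann, C. R. Math. Acad. Sci. Paris 350 (2012) 757–760, Lemma 4,
  Thm. 5 and its proof, system (6) (`BardosTitiWiedemann2012`).
* C. Bardos, E. S. Titi, Discrete Contin. Dyn. Syst. Ser. S 3 (2010) 185–197, Thm. 2
  (the shear flow as a weak solution) (`BardosTiti2010`).
* R. J. DiPerna, P.-L. Lions, Invent. Math. 98 (1989), §II.1 (weak solutions of transport
  equations) (`DiPernaLions1989`).
* R. J. DiPerna, A. J. Majda, Comm. Math. Phys. 108 (1987), §1 (weak-* limits in `L^∞_t L²_x`)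
  (`DiPernaMajda1987`).
* J. Leray, Acta Math. 63 (1934), (5.2) (energy inequality) (`Leray1934`).
-/

open MeasureTheory Set Filter Topology
open scoped ENNReal NNReal InnerProductSpace

noncomputable section

namespace Literature.Barriers.AnomalousDissipation

/-- The flat three-torus `T³ = (ℝ/ℤ)³` (local notation). -/
local notation "𝕋³" => UnitAddTorus (Fin 3)
/-- The flat two-torus `T² = (ℝ/ℤ)²` (local notation). -/
local notation "𝕋²" => UnitAddTorus (Fin 2)
/-- Velocity values (local notation). -/
local notation "E³" => EuclideanSpace ℝ (Fin 3)

/-! ## The planar shear transport of Lemma 4 -/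

/-- **The planar shear velocity field** `(x₁, x₂) ↦ (v(x₂), 0)` on `T²`, constant in time, of
the linear transport equation `∂ₜw + v(x₂)∂_{x₁}w = 0` of Bardos–Titi–Wiedemann 2012, Lemma 4
(paper coordinates `x₁, x₂` ↦ indices `0, 1`; time first, as for all velocity fields of
`Torus.IsWeakScalarTransportOn`). [cite: BardosTitiWiedemann2012, Lemma 4] -/
def shearVelocity (v : UnitAddCircle → ℝ) : ℝ → 𝕋² → EuclideanSpace ℝ (Fin 2) :=
  fun _ x => !₂[v (x 1), 0]

/-- **The shear transport** `w(x, t) = w₀(x₁ - t v(x₂), x₂)` of a profile `w₀ : T² → ℝ` by the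
shear velocity `(v(x₂), 0)`: the explicit solution of the Cauchy problem of Lemma 4 and the third
component of the shear flow (4) (Bardos–Titi–Wiedemann 2012, (4) and Lemma 4; Bardos–Titi 2010,
(1)); the shift `t v(x₂)` is taken in `ℝ/ℤ`. [cite: BardosTitiWiedemann2012, §2 (4)] -/
def shearTransport (v : UnitAddCircle → ℝ) (w₀ : 𝕋² → ℝ) (t : ℝ) : 𝕋² → ℝ :=
  fun x => w₀ ![x 0 - ((t * v (x 1) : ℝ) : UnitAddCircle), x 1]

/-- At `t = 0` the shear transport is the profile. [folklore] -/
theorem shearTransport_zero (v : UnitAddCircle → ℝ) (w₀ : 𝕋² → ℝ) : shearTransport v w₀ 0 = w₀ := by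
  funext x
  simp only [shearTransport, zero_mul, QuotientAddGroup.mk_zero, sub_zero]
  congr 1
  ext i
  fin_cases i <;> rfl

/-- **The third component of the shear flow is the shear transport of `v₃`**:
`v(x,t)₃ = v₃(x₁ - t v₁(x₂), x₂) = (shearTransport v₁ v₃ t)(x₁, x₂)` (Bardos–Titi–Wiedemann
2012, (4) versus system (6)); the first component is `v₁(x₂)` and the second vanishes. [cite: BardosTitiWiedemann2012, §2 (4)] -/
theorem shearFlow_apply (v₁ : UnitAddCircle → ℝ) (v₃ : 𝕋² → ℝ) (t : ℝ) (x : 𝕋³) :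
    shearFlow v₁ v₃ t x 0 = v₁ (x 1) ∧ shearFlow v₁ v₃ t x 1 = 0 ∧
      shearFlow v₁ v₃ t x 2 = shearTransport v₁ v₃ t ![x 0, x 1] := by
  simp [shearFlow, shearTransport]

/-- The shear velocity field does not depend on `x₁`: it is invariant under translations along
the first axis. [folklore] -/
theorem shearVelocity_add_single_zero (v : UnitAddCircle → ℝ) (t : ℝ) (s : UnitAddCircle) (x : 𝕋²) :
    shearVelocity v t (x + Pi.single 0 s) = shearVelocity v t x := by
  simp [shearVelocity]

/-! ## Lemma 4 (named fact) -/

/-- **Bardos–Titi–Wiedemann 2012, Lemma 4** (named fact, as printed). "Let `v ∈ L²(T;ℝ)` and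
`w₀ ∈ L²(T²)`. Then the Cauchy problem for the linear transport equation
`∂ₜw(x₁,x₂,t) + v(x₂)∂_{x₁}w(x₁,x₂,t) = 0`, `w(·,0) = w₀` has a solution
`w ∈ C([0,T];L²_w(T²))`, satisfying the equation in the sense of distributions, and this solution
is unique in the class `L^∞((0,T);L²(T²))`. We omit the elementary proof of the Lemma."
Rendering: `T > 0`; "solution in the sense of distributions" with datum is the accepted
DiPerna–Lions weak formulation `Torus.IsWeakScalarTransportOn T 0 (shearVelocity v) w₀ w` on
`T² × [0,T)` (`κ = 0`, velocity `(v(x₂),0)`, smooth space–time tests possibly nonzero at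
`t = 0`; its membership clause is exactly `w ∈ L^∞(0,T;L²(T²))`, and the integrability clauses
`u ∈ L¹_t L²_x`, `u w ∈ L¹_{t,x}` it carries are automatic here); `C([0,T];L²_w)` as: every
slice `w t`, `t ∈ [0,T]`, lies in `L²` and `t ↦ ∫ w(t) g` is continuous on `[0,T]` for every
`g ∈ L²`, with `w(0) = w₀` a.e.; uniqueness as a.e. agreement on a.e. time slice of `(0,T)`
(the class `L^∞(0,T;L²)` sees `w` only a.e. in space–time). The solution is the shear transport
`shearTransport v w₀` (Bardos–Titi 2010, Thm. 2); the fact records only what is printed. [cite: BardosTitiWiedemann2012, Lemma 4] -/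
def BardosTitiWiedemann2012_lemma4 : Prop :=
  ∀ (v : UnitAddCircle → ℝ) (_hv : MemLp v 2 volume) (w₀ : 𝕋² → ℝ) (_hw₀ : MemLp w₀ 2 volume)
    (T : ℝ) (_hT : 0 < T),
    (∃ w : ℝ → 𝕋² → ℝ,
      Literature.Analysis.FluidPDE.Torus.IsWeakScalarTransportOn T 0 (shearVelocity v) w₀ w ∧
      (∀ t ∈ Icc 0 T, MemLp (w t) 2 volume) ∧
      (∀ g : 𝕋² → ℝ, MemLp g 2 volume → ContinuousOn (fun t => ∫ x, w t x * g x) (Icc 0 T)) ∧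
      w 0 =ᵐ[volume] w₀) ∧
    ∀ w w' : ℝ → 𝕋² → ℝ,
      Literature.Analysis.FluidPDE.Torus.IsWeakScalarTransportOn T 0 (shearVelocity v) w₀ w →
      Literature.Analysis.FluidPDE.Torus.IsWeakScalarTransportOn T 0 (shearVelocity v) w₀ w' →
      ∀ᵐ t ∂(volume.restrict (Ioo 0 T)), w t =ᵐ[volume] w' t

/-! ## The subsequential vanishing-viscosity limit (named fact) -/

/-- **Bardos–Titi–Wiedemann 2012, proof of Thm. 5: subsequences of Leray–Hopf solutions with
shear datum converge weak-* to the shear flow** (named fact). For `v₁ ∈ L²(T)`, `v₃ ∈ L²(T²)`,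
`T > 0`, viscosities `ν_j > 0` with `ν_j → 0` and Leray–Hopf weak solutions `u_j` of the
unforced Navier–Stokes equations on `T³ × [0,T)` with viscosity `ν_j` and datum
`v₀ = (v₁(x₂), 0, v₃(x₁,x₂))`, some subsequence `u_{φ(k)}` converges weak-* in
`L^∞(0,T;L²(T³))` (accepted `Torus.TendstoWeakStar`: bounded in `L^∞_t L²_x`, convergent against
smooth test fields supported in `(0,T)`) to the shear flow `v(x,t) = (v₁(x₂), 0,
v₃(x₁ - t v₁(x₂), x₂))`: "since the family of unique solutions, `u^ν`, is uniformly bounded in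
`L^∞_t L²_x`, there exists a subsequence `u^{ν_k}` which converges weak-* to `u ∈ L^∞_t L²_x`, and
`u` satisfies (6) … Indeed, the equation for `u₃` follows from `u₁^ν u₃^ν ⇀* u₁u₃`, thanks to
the strong convergence of `u₁^ν` to `u₁`. Next, it follows from Lemma 4 above that system (6)
has a unique solution, and that this unique solution is given precisely by the shear flow (4)"
(op. cit., proof of Thm. 5; the `u^ν` being *the* Leray–Hopf solutions by the uniqueness part,
`BardosTitiWiedemann2012_thm5_uniqueness`, of the ansatz form
`BardosTitiWiedemann2012_thm5_shearLerayHopf`, with `u₁^ν` the heat flow of `v₁`). Quantified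
over all vanishing-viscosity Leray–Hopf sequences this is **equivalent** to part (iii) of
`BardosTitiWiedemann2012_thm5`: part (iii) follows from it by the sub-subsequence principle
(`BardosTitiWiedemann2012_thm5_limit_of_subseqLimit`), and implies it with `φ = id`
(`BardosTitiWiedemann2012_thm5_subseqLimit_of_thm5`); the subsequential shape is the one that
compactness arguments deliver. [cite: BardosTitiWiedemann2012, Thm. 5, proof] -/
def BardosTitiWiedemann2012_thm5_subseqLimit : Prop :=
  ∀ (v₁ : UnitAddCircle → ℝ) (_hv₁ : MemLp v₁ 2 volume) (v₃ : 𝕋² → ℝ) (_hv₃ : MemLp v₃ 2 volume)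
    (T : ℝ) (_hT : 0 < T) (ν : ℕ → ℝ) (_hν : ∀ j, 0 < ν j) (_hν₀ : Tendsto ν atTop (𝓝 0))
    (u : ℕ → ℝ → 𝕋³ → E³)
    (_hu : ∀ j, Literature.Analysis.FluidPDE.Torus.IsLerayHopfOn T (ν j) 0 (shearData v₁ v₃) (u j)),
    ∃ φ : ℕ → ℕ, StrictMono φ ∧
      Literature.Analysis.FluidPDE.Torus.TendstoWeakStar (u ∘ φ) (shearFlow v₁ v₃) T

/-! ## Proved: the uniform energy bound and the sub-subsequence principle -/

section General

variable {d : Type*} [Fintype d]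

/-- For an `L²` field on the torus the extended energy is `2E`: `∫⁻ ‖w‖ₑ² = ofReal (2 · ½∫‖w‖²)`
(torus twin of the accepted `Literature.Analysis.FluidPDE.eEnergy_eq_ofReal`; Majda–Bertozzi
(1.28)). [folklore] -/
theorem lintegral_enorm_sq_eq_ofReal_kineticEnergy {w : UnitAddTorus d → EuclideanSpace ℝ d}
    (hw : MemLp w 2 volume) :
    ∫⁻ x, ‖w x‖ₑ ^ 2 = ENNReal.ofReal (2 * Literature.Analysis.FunctionSpaces.Torus.kineticEnergy w) := by
  have hint : Integrable (fun x => ‖w x‖ ^ 2) volume := hw.integrable_norm_pow two_ne_zero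
  rw [Literature.Analysis.FunctionSpaces.Torus.kineticEnergy, ← mul_assoc, mul_inv_cancel₀ two_ne_zero,
    one_mul, ofReal_integral_eq_lintegral_ofReal hint (Eventually.of_forall fun _ => sq_nonneg _)]
  refine lintegral_congr fun x => ?_
  rw [← ofReal_norm, ENNReal.ofReal_pow (norm_nonneg _)]

variable [DecidableEq d]

/-- **Uniform energy bound of unforced Leray–Hopf solutions** (Leray 1934, (5.2); Galdi 2000,
Def. 2.1 (ii)): for `ν ≥ 0`, a datum `u₀ ∈ L²` and an unforced Leray–Hopf solution `u` on
`T^d × [0,T)`, `∫⁻ ‖u(t)‖ₑ² ≤ ∫⁻ ‖u₀‖ₑ²` for every `t ∈ [0,T]` — the energy inequality from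
`s = 0` with the dissipation dropped, transported to lower Lebesgue integrals through
`lintegral_enorm_sq_eq_ofReal_kineticEnergy` (every slice is `L²`, field `memLp`). This is the
"uniformly bounded in `L^∞_t L²_x`" of Bardos–Titi–Wiedemann 2012, proof of Thm. 5. [cite: Leray1934, (5.2)] -/
theorem lintegral_enorm_sq_le_of_isLerayHopfOn {T ν : ℝ} (hν : 0 ≤ ν)
    {u₀ : UnitAddTorus d → EuclideanSpace ℝ d} {u : ℝ → UnitAddTorus d → EuclideanSpace ℝ d}
    (h : Literature.Analysis.FluidPDE.Torus.IsLerayHopfOn T ν 0 u₀ u) (hu₀ : MemLp u₀ 2 volume) {t : ℝ}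
    (ht : t ∈ Icc 0 T) : ∫⁻ x, ‖u t x‖ₑ ^ 2 ≤ ∫⁻ x, ‖u₀ x‖ₑ ^ 2 := by
  have hle := h.energy_ineq_zero t ht
  simp only [Pi.zero_apply, inner_zero_left, integral_zero, intervalIntegral.integral_zero,
    add_zero] at hle
  have hkin : Literature.Analysis.FunctionSpaces.Torus.kineticEnergy (u t) ≤
      Literature.Analysis.FunctionSpaces.Torus.kineticEnergy u₀ :=
    le_trans (le_add_of_nonneg_right (mul_nonneg hν ENNReal.toReal_nonneg)) hle
  rw [lintegral_enorm_sq_eq_ofReal_kineticEnergy (h.memLp t ht),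
    lintegral_enorm_sq_eq_ofReal_kineticEnergy hu₀]
  exact ENNReal.ofReal_le_ofReal (by linarith)

omit [DecidableEq d] in
/-- **The sub-subsequence principle for weak-* convergence in `L^∞(0,T;L²(T^d))`**: a sequence
bounded in `L^∞_t L²_x` converges weak-* to `u` as soon as every subsequence has a further
subsequence converging weak-* to `u` (Mathlib's `Filter.tendsto_of_subseq_tendsto`, test field
by test field). This is the closing step "this uniqueness implies that the whole sequence `u^ν`,
and not just a subsequence, converges" of Bardos–Titi–Wiedemann 2012, proof of Thm. 5. [folklore] -/
theorem tendstoWeakStar_of_forall_subseq {useq : ℕ → ℝ → UnitAddTorus d → EuclideanSpace ℝ d}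
    {u : ℝ → UnitAddTorus d → EuclideanSpace ℝ d} {T : ℝ}
    (hb : ∃ C : ℝ≥0, ∀ m, ∀ᵐ t ∂(volume.restrict (Ioo 0 T)), ∫⁻ x, ‖useq m t x‖ₑ ^ 2 ≤ C)
    (h : ∀ ns : ℕ → ℕ, Tendsto ns atTop atTop →
      ∃ ms : ℕ → ℕ, Literature.Analysis.FluidPDE.Torus.TendstoWeakStar (useq ∘ ns ∘ ms) u T) :
    Literature.Analysis.FluidPDE.Torus.TendstoWeakStar useq u T := by
  refine ⟨hb, fun ψ hψ => tendsto_of_subseq_tendsto fun ns hns => ?_⟩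
  obtain ⟨ms, hms⟩ := h ns hns
  exact ⟨ms, hms.2 ψ hψ⟩

end General

/-! ## Proved: part (iii) from the subsequential limit, and the assembly of Thm. 5 -/

/-- **Part (iii) of Thm. 5 from the subsequential limit.** Under
`BardosTitiWiedemann2012_thm5_subseqLimit`, every vanishing-viscosity sequence of Leray–Hopf
solutions with shear datum converges weak-* to the shear flow — the whole sequence: it is
bounded in `L^∞_t L²_x` by the initial energy (`lintegral_enorm_sq_le_of_isLerayHopfOn`,
`memLp_shearData`), and every subsequence is again a vanishing-viscosity Leray–Hopf sequence, so
has a sub-subsequence converging weak-* to the shear flow; conclude by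
`tendstoWeakStar_of_forall_subseq` (Bardos–Titi–Wiedemann 2012, proof of Thm. 5, last
sentence). [cite: BardosTitiWiedemann2012, Thm. 5, proof] -/
theorem BardosTitiWiedemann2012_thm5_limit_of_subseqLimit
    (hlim : BardosTitiWiedemann2012_thm5_subseqLimit)
    (v₁ : UnitAddCircle → ℝ) (hv₁ : MemLp v₁ 2 volume) (v₃ : 𝕋² → ℝ) (hv₃ : MemLp v₃ 2 volume)
    (T : ℝ) (hT : 0 < T) (ν : ℕ → ℝ) (hν : ∀ j, 0 < ν j) (hν₀ : Tendsto ν atTop (𝓝 0))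
    (u : ℕ → ℝ → 𝕋³ → E³)
    (hu : ∀ j, Literature.Analysis.FluidPDE.Torus.IsLerayHopfOn T (ν j) 0 (shearData v₁ v₃) (u j)) :
    Literature.Analysis.FluidPDE.Torus.TendstoWeakStar u (shearFlow v₁ v₃) T := by
  have hmem : MemLp (shearData v₁ v₃) 2 volume := memLp_shearData hv₁ hv₃
  refine tendstoWeakStar_of_forall_subseq ?_ fun ns hns => ?_
  · refine ⟨(2 * Literature.Analysis.FunctionSpaces.Torus.kineticEnergy (shearData v₁ v₃)).toNNReal,
      fun m => (ae_restrict_mem measurableSet_Ioo).mono fun t ht => ?_⟩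
    calc ∫⁻ x, ‖u m t x‖ₑ ^ 2 ≤ ∫⁻ x, ‖shearData v₁ v₃ x‖ₑ ^ 2 :=
          lintegral_enorm_sq_le_of_isLerayHopfOn (hν m).le (hu m) hmem (Ioo_subset_Icc_self ht)
      _ = ENNReal.ofReal (2 * Literature.Analysis.FunctionSpaces.Torus.kineticEnergy (shearData v₁ v₃)) :=
          lintegral_enorm_sq_eq_ofReal_kineticEnergy hmem
      _ = _ := rfl
  · obtain ⟨φ, -, hφ⟩ := hlim v₁ hv₁ v₃ hv₃ T hT (ν ∘ ns) (fun j => hν (ns j)) (hν₀.comp hns)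
      (u ∘ ns) fun j => hu (ns j)
    exact ⟨φ, hφ⟩

/-- **Converse: part (iii) of Thm. 5 gives the subsequential limit with `φ = id`** — so
`BardosTitiWiedemann2012_thm5_subseqLimit` is equivalent to conjunct (iii) of
`BardosTitiWiedemann2012_thm5` (Bardos–Titi–Wiedemann 2012, Thm. 5). [cite: BardosTitiWiedemann2012, Thm. 5] -/
theorem BardosTitiWiedemann2012_thm5_subseqLimit_of_thm5 (h : BardosTitiWiedemann2012_thm5) :
    BardosTitiWiedemann2012_thm5_subseqLimit :=
  fun v₁ hv₁ v₃ hv₃ T hT ν hν hν₀ u hu =>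
    ⟨id, strictMono_id, (h v₁ hv₁ v₃ hv₃ T hT).2 ν hν hν₀ u hu⟩

/-- **Assembly of Bardos–Titi–Wiedemann 2012, Thm. 5, from the two named facts.** Parts
(i)–(ii) are `BardosTitiWiedemann2012_thm5_wellposed` (existence proved from Hopf's theorem in
`ShearFlowViscositySelectionSteps`, uniqueness the named fact
`BardosTitiWiedemann2012_thm5_uniqueness`); part (iii) is
`BardosTitiWiedemann2012_thm5_limit_of_subseqLimit` from the named fact
`BardosTitiWiedemann2012_thm5_subseqLimit`. The discharge `BardosTitiWiedemann2012_thm5_holds`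
is this theorem applied to the two discharges, once they land. [cite: BardosTitiWiedemann2012, Thm. 5] -/
theorem BardosTitiWiedemann2012_thm5_of_facts (huniq : BardosTitiWiedemann2012_thm5_uniqueness)
    (hlim : BardosTitiWiedemann2012_thm5_subseqLimit) : BardosTitiWiedemann2012_thm5 :=
  fun v₁ hv₁ v₃ hv₃ T hT =>
    ⟨BardosTitiWiedemann2012_thm5_wellposed huniq v₁ hv₁ v₃ hv₃ T hT,
      fun ν hν hν₀ u hu =>
        BardosTitiWiedemann2012_thm5_limit_of_subseqLimit hlim v₁ hv₁ v₃ hv₃ T hT ν hν hν₀ u hu⟩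

end Literature.Barriers.AnomalousDissipation

end
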